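import Mathlib
import Summits.ResolutionOfSingularities.ResolutionOfSingularities.Theorems.RadicialJungCleanModelsBadSetDescentData
import Summits.ResolutionOfSingularities.ResolutionOfSingularities.Theorems.RadicialJungCleanModelsContactChainGenericPermissible
import HarnessLib

/-!
# Route `RadicialJung`, crux `CleanModels` (stmt-ResolutionOfSingularities-15917), line `Sketch` rev 35, stub 6 `stub_cleanProp44` (X44c),
# work plan O8 — **L7b-GLOBAL**: finitely many chains of point blow-ups make a regular curve clean-permissible at EVERY point

Memo `Cruxes/CleanModels/Lines/Sketch-memo-hand2-g9-stubs-5-7.md` §3/§3a/§3b «L7b-global».  On a regular integral locally Noetherian quasi-excellent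
`X₀` (`char K(X₀) = p`), let `C₀ = cl{η}` be a regular curve (ideal generated by a regular pair at each point) which is one-dimensional (points
other than `η` closed in `X₀`, with three-dimensional local rings of `X₀`), and let the line of `G` be clean-permissible for `C₀` at `η`, fail to be
so at only FINITELY many points (✓ `finite_setOf_not_cleanPermissibleAt_of_cleanRegAt_genericPoint`, `…GenericSpreadSchemeFinite.lean`, on Noetherian
`X₀`), and be clean-REGULAR at each of these bad points (as on every stage of X44c).  Then there are an integral locally Noetherian `X`, a PROPER
dominant `σ : X → X₀` which is an ISOMORPHISM over every open on which `C₀` has no bad point, and a regular curve `C = cl{η'} ⊆ X`, `σ η' = η`,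
regular pair at each point, `X` regular and quasi-excellent, such that the line of `σ^♯ G` is clean-permissible for `C` at EVERY point of `C`
(`exists_proper_isIso_forall_cleanPermissibleAt` — induction on the number of bad points: descent step ✓ `exists_pointChain_ncard_bad_lt`,
persistence ✓ `IsPointChainAlong.curve_data`, transport ✓ p816554).

Honest framing: OURS; this is L7b-global of the X44c work plan with a def-free output (proper, iso off the bad points); recording `σ` as a
clean-permissible Cossart–Piltant sequence (`IsCleanRegularCentreBlowupSeq`, O6) is not done here; nothing here proves X44c or any case of `CleanModels`.
-/

noncomputable section

set_option linter.dupNamespace false -- mandated namespace of this single-conjunct summit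

open CategoryTheory AlgebraicGeometry TopologicalSpace IsLocalRing Opposite
open Literature.AlgebraicGeometry.Resolution Literature.AlgebraicGeometry.Motives
open Scheme.IdealSheafData

namespace Summit.ResolutionOfSingularities.ResolutionOfSingularities.Theorems.RadicialJung.CleanModels

universe u

/-- A chain of point blow-ups is proper. [cite: StacksProject, Tag 02ND] -/
theorem IsPointChainAlong.isProper {X₀ X : Scheme.{u}} {σ : X ⟶ X₀} {C₀ : Closeds X₀} {C : Closeds X} {x : X} {n : ℕ}
    (h : IsPointChainAlong σ C₀ C x n) : IsProper σ := by
  induction h with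
  | nil C₀ x₀ => infer_instance
  | cons σ C₀ C n τ x' hx hchain hYreg hτ hx' ih =>
    haveI := ih
    haveI := hτ.isProper
    infer_instance

/-- ✓ `exists_pointChain_ncard_bad_lt` (`…BadSetDescent.lean`) exporting moreover that the END POINT of the chain is clean-permissible. [cite: CossartPiltant2008, Prop. 4.4 (proof, p. 10)]
[cite: Piltant2013, §2 Axiom 4] [cite: CossartJannsenSaito2020, proof of Thm. 6.28, Step 5] -/
theorem exists_pointChain_good_ncard_bad_lt {X₀ : Scheme.{0}} [IsIntegral X₀] [IsLocallyNoetherian X₀] (hX₀ : Scheme.IsRegular X₀)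
    (hE : Scheme.IsQuasiExcellent X₀) (p : ℕ) [hp : Fact p.Prime] [CharP X₀.functionField p] {C₀ : Closeds X₀}
    (hC₀reg : ∀ y ∈ (C₀ : Set X₀), ∃ c : Fin 2 → X₀.presheaf.stalk y,
      IsRsopPart c ∧ Ideal.span (Set.range c) = stalkIdeal (vanishingIdeal C₀) y)
    {η : X₀} (hη : (C₀ : Set X₀) = closure {η}) (hcl : ∀ y ∈ (C₀ : Set X₀), y ≠ η → IsClosed ({y} : Set X₀))
    (hdim3 : ∀ y ∈ (C₀ : Set X₀), y ≠ η → ringKrullDim (X₀.presheaf.stalk y) = 3) (G : X₀.functionField)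
    (hfin : {y : X₀ | y ∈ (C₀ : Set X₀) ∧ ¬ CleanPermissibleAt p (RatFn.toFunctionField y) G (stalkIdeal (vanishingIdeal C₀) y)}.Finite)
    {x₀ : X₀} (hx₀C : x₀ ∈ (C₀ : Set X₀)) (hx₀η : x₀ ≠ η)
    (hx₀bad : ¬ CleanPermissibleAt p (RatFn.toFunctionField x₀) G (stalkIdeal (vanishingIdeal C₀) x₀))
    (hGx₀ : CleanRegAt p (RatFn.toFunctionField x₀) G) :
    ∃ (X : Scheme.{0}) (_ : IsIntegral X) (_ : IsLocallyNoetherian X) (σ : X ⟶ X₀) (_ : IsDominant σ) (C : Closeds X) (x : X) (n : ℕ),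
      IsPointChainAlong σ C₀ C x n ∧ σ x = x₀ ∧ IsClosed ({x} : Set X) ∧
      CleanPermissibleAt p (RatFn.toFunctionField x) (RatFn.functionFieldMap σ G) (stalkIdeal (vanishingIdeal C) x) ∧
      {y : X | y ∈ (C : Set X) ∧
        ¬ CleanPermissibleAt p (RatFn.toFunctionField y) (RatFn.functionFieldMap σ G) (stalkIdeal (vanishingIdeal C) y)}.Finite ∧
      {y : X | y ∈ (C : Set X) ∧
        ¬ CleanPermissibleAt p (RatFn.toFunctionField y) (RatFn.functionFieldMap σ G) (stalkIdeal (vanishingIdeal C) y)}.ncard <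
      {y : X₀ | y ∈ (C₀ : Set X₀) ∧ ¬ CleanPermissibleAt p (RatFn.toFunctionField y) G (stalkIdeal (vanishingIdeal C₀) y)}.ncard := by
  classical
  have hx₀cl : IsClosed ({x₀} : Set X₀) := hcl x₀ hx₀C hx₀η
  have hdim₀ : ringKrullDim (X₀.presheaf.stalk x₀) = 3 := hdim3 x₀ hx₀C hx₀η
  haveI : IsRegularLocalRing (X₀.presheaf.stalk x₀) := hX₀ x₀
  obtain ⟨c2, hc2, hc2P⟩ := hC₀reg x₀ hx₀C
  -- `𝓘_{C₀,x₀}` is prime (it is the prime of the generisation `η ⤳ x₀`)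
  have hspec₀ : η ⤳ x₀ := by rw [specializes_iff_mem_closure, ← hη]; exact hx₀C
  have hC₀eq : C₀ = ⟨closure {η}, isClosed_closure⟩ := Closeds.ext hη
  haveI hP : (stalkIdeal (vanishingIdeal C₀) x₀).IsPrime := by
    have h1 : stalkIdeal (vanishingIdeal C₀) x₀ = primeOfSpecializes hspec₀ := by
      have := stalkIdeal_vanishingIdeal_closure (X := X₀) hspec₀
      rwa [← hC₀eq] at this
    rw [h1]; infer_instance
  obtain ⟨w, hw⟩ := exists_transversal_of_isRsopPart_pair c2 hc2 hc2P hdim₀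
  -- L7b at `x₀`
  obtain ⟨X, hXi, hXn, σ, hσd, C, x, n, hchain, hσx, hxcl, hperm⟩ :=
    exists_pointChain_cleanPermissibleAt_of_cleanRegAt hX₀ hE p hC₀reg hx₀cl hx₀C hdim₀ w hw G hGx₀
  refine ⟨X, hXi, hXn, σ, hσd, C, x, n, hchain, hσx, hxcl, hperm, ?_⟩
  subst hσx
  set Bad₀ := {y : X₀ | y ∈ (C₀ : Set X₀) ∧ ¬ CleanPermissibleAt p (RatFn.toFunctionField y) G (stalkIdeal (vanishingIdeal C₀) y)}
    with hBad₀
  set Bad := {y : X | y ∈ (C : Set X) ∧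
    ¬ CleanPermissibleAt p (RatFn.toFunctionField y) (RatFn.functionFieldMap σ G) (stalkIdeal (vanishingIdeal C) y)} with hBad
  -- every bad point of `C` lies over a bad point of `C₀` other than `σ x`
  have hover : ∀ y ∈ Bad, σ y ∈ Bad₀ \ {σ x} := by
    rintro y ⟨hyC, hybad⟩
    have hne : σ y ≠ σ x := by
      intro heq
      have hyx : y = x := hchain.eq_of_mem_of_eq hX₀ hC₀reg hx₀C hdim₀ y hyC heq
      rw [hyx] at hybad
      exact hybad hperm
    have hyC₀ : σ y ∈ (C₀ : Set X₀) := by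
      have h1 : y ∈ (C : Set X) ∩ σ ⁻¹' {σ x}ᶜ := ⟨hyC, hne⟩
      rw [hchain.inter_preimage_compl hx₀cl] at h1
      exact h1.1
    refine ⟨⟨hyC₀, fun hgood => hybad (hchain.cleanPermissibleAt_of_ne hx₀cl p G y hne hgood)⟩, hne⟩
  -- `σ` is injective on the bad set (an isomorphism off `σ x`)
  set U : X₀.Opens := ⟨{σ x}ᶜ, hx₀cl.isOpen_compl⟩ with hU
  haveI : IsIso (σ ∣_ U) := hchain.isIso_morphismRestrict U (fun h => h rfl)
  have hinj : Set.InjOn (fun y => σ y) Bad := fun a ha b hb hab =>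
    injOn_preimage_of_isIso_morphismRestrict σ U (hover a ha).2 (hover b hb).2 hab
  have hfin' : Bad.Finite :=
    Set.Finite.of_finite_image ((hfin.sdiff).subset (by rintro _ ⟨y, hy, rfl⟩; exact hover y hy)) hinj
  refine ⟨hfin', ?_⟩
  have hle : Bad.ncard ≤ (Bad₀ \ {σ x}).ncard := Set.ncard_le_ncard_of_injOn (fun y => σ y) hover hinj hfin.sdiff
  have hmem : σ x ∈ Bad₀ := ⟨hx₀C, hx₀bad⟩
  have hcard : (Bad₀ \ {σ x}).ncard + 1 = Bad₀.ncard := Set.ncard_sdiff_singleton_add_one hmem hfin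
  omega


/-- **L7b-global.**  See the module docstring; `N` bounds the number of bad points (induction). [cite: CossartPiltant2008, Prop. 4.4 (proof, p. 10)]
[cite: Piltant2013, §2 Axiom 4] [cite: CossartJannsenSaito2020, proof of Thm. 6.28, Step 5] -/
theorem exists_proper_isIso_forall_cleanPermissibleAt_of_ncard_le (p : ℕ) [hp : Fact p.Prime] (N : ℕ) :
    ∀ {X₀ : Scheme.{0}} [IsIntegral X₀] [IsLocallyNoetherian X₀] (_ : Scheme.IsRegular X₀) (_ : Scheme.IsQuasiExcellent X₀)
      [CharP X₀.functionField p] {C₀ : Closeds X₀}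
      (_ : ∀ y ∈ (C₀ : Set X₀), ∃ c : Fin 2 → X₀.presheaf.stalk y, IsRsopPart c ∧ Ideal.span (Set.range c) = stalkIdeal (vanishingIdeal C₀) y)
      {η : X₀} (_ : (C₀ : Set X₀) = closure {η}) (_ : ∀ y ∈ (C₀ : Set X₀), y ≠ η → IsClosed ({y} : Set X₀))
      (_ : ∀ y ∈ (C₀ : Set X₀), y ≠ η → ringKrullDim (X₀.presheaf.stalk y) = 3) (G : X₀.functionField)
      (_ : CleanPermissibleAt p (RatFn.toFunctionField η) G (stalkIdeal (vanishingIdeal C₀) η))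
      (_ : ∀ y ∈ (C₀ : Set X₀), ¬ CleanPermissibleAt p (RatFn.toFunctionField y) G (stalkIdeal (vanishingIdeal C₀) y) →
        CleanRegAt p (RatFn.toFunctionField y) G)
      (_ : {y : X₀ | y ∈ (C₀ : Set X₀) ∧ ¬ CleanPermissibleAt p (RatFn.toFunctionField y) G (stalkIdeal (vanishingIdeal C₀) y)}.Finite)
      (_ : {y : X₀ | y ∈ (C₀ : Set X₀) ∧ ¬ CleanPermissibleAt p (RatFn.toFunctionField y) G (stalkIdeal (vanishingIdeal C₀) y)}.ncard ≤ N),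
    ∃ (X : Scheme.{0}) (_ : IsIntegral X) (_ : IsLocallyNoetherian X) (σ : X ⟶ X₀) (_ : IsDominant σ) (C : Closeds X) (η' : X),
      IsProper σ ∧
      (∀ U : X₀.Opens, (∀ y ∈ (C₀ : Set X₀), y ∈ U → CleanPermissibleAt p (RatFn.toFunctionField y) G (stalkIdeal (vanishingIdeal C₀) y)) →
        IsIso (σ ∣_ U)) ∧
      Scheme.IsRegular X ∧ Scheme.IsQuasiExcellent X ∧
      (∀ y ∈ (C : Set X), ∃ c : Fin 2 → X.presheaf.stalk y, IsRsopPart c ∧ Ideal.span (Set.range c) = stalkIdeal (vanishingIdeal C) y) ∧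
      (C : Set X) = closure {η'} ∧ σ η' = η ∧
      ∀ y ∈ (C : Set X), CleanPermissibleAt p (RatFn.toFunctionField y) (RatFn.functionFieldMap σ G) (stalkIdeal (vanishingIdeal C) y) := by
  induction N with
  | zero =>
    intro X₀ _ _ hX₀ hE _ C₀ hC₀reg η hη hcl hdim3 G hηgood hGbad hfin hN
    have hgood : ∀ y ∈ (C₀ : Set X₀), CleanPermissibleAt p (RatFn.toFunctionField y) G (stalkIdeal (vanishingIdeal C₀) y) := by
      intro y hy
      by_contra hbad
      have h0 := (Set.ncard_eq_zero hfin).mp (Nat.le_zero.mp hN)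
      have hmem : y ∈ {y : X₀ | y ∈ (C₀ : Set X₀) ∧
          ¬ CleanPermissibleAt p (RatFn.toFunctionField y) G (stalkIdeal (vanishingIdeal C₀) y)} := ⟨hy, hbad⟩
      rw [h0] at hmem
      exact hmem
    refine ⟨X₀, inferInstance, inferInstance, 𝟙 X₀, inferInstance, C₀, η, inferInstance, fun U _ => inferInstance, hX₀, hE, hC₀reg, hη,
      rfl, ?_⟩
    intro y hy
    rw [RatFn.functionFieldMap_id, RingHom.id_apply]
    exact hgood y hy
  | succ N ih =>
    intro X₀ _ _ hX₀ hE _ C₀ hC₀reg η hη hcl hdim3 G hηgood hGbad hfin hN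
    classical
    by_cases hle : {y : X₀ | y ∈ (C₀ : Set X₀) ∧
        ¬ CleanPermissibleAt p (RatFn.toFunctionField y) G (stalkIdeal (vanishingIdeal C₀) y)}.ncard ≤ N
    · exact ih hX₀ hE hC₀reg hη hcl hdim3 G hηgood hGbad hfin hle
    -- a bad point `x₀ ≠ η`
    have hne : {y : X₀ | y ∈ (C₀ : Set X₀) ∧
        ¬ CleanPermissibleAt p (RatFn.toFunctionField y) G (stalkIdeal (vanishingIdeal C₀) y)}.Nonempty := by
      rw [Set.nonempty_iff_ne_empty]
      intro h0
      apply hle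
      rw [h0, Set.ncard_empty]; exact Nat.zero_le _
    obtain ⟨x₀, hx₀C, hx₀bad⟩ := hne
    have hx₀η : x₀ ≠ η := by rintro rfl; exact hx₀bad hηgood
    -- the descent step: one chain at `x₀`
    obtain ⟨X₁, hX₁i, hX₁n, σ₁, hσ₁d, C₁, x₁, n₁, hchain, hσx, hx₁cl, hx₁good, hfin₁, hlt⟩ :=
      exists_pointChain_good_ncard_bad_lt hX₀ hE p hC₀reg hη hcl hdim3 G hfin hx₀C hx₀η hx₀bad (hGbad x₀ hx₀C hx₀bad)
    subst hσx
    haveI : CharP X₁.functionField p := charP_of_injective_ringHom (RatFn.functionFieldMap σ₁).injective p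
    have hx₀cl : IsClosed ({σ₁ x₁} : Set X₀) := hcl _ hx₀C hx₀η
    have hdim₀ : ringKrullDim (X₀.presheaf.stalk (σ₁ x₁)) = 3 := hdim3 _ hx₀C hx₀η
    obtain ⟨hX₁, hC₁reg, -, -⟩ := data_along_pointChain hchain hX₀ hC₀reg hx₀C hdim₀
    have hE₁ : Scheme.IsQuasiExcellent X₁ := hchain.isQuasiExcellent hE
    obtain ⟨η₁, hη₁C, hση₁, hη₁, hcl₁, hdim3₁, hoff⟩ := hchain.curve_data hX₀ hC₀reg hη hcl hdim3 hx₀C hx₀η hx₁cl p G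
    -- transport of clean-permissibility off the base point
    have htransport : ∀ y ∈ (C₁ : Set X₁), y ≠ x₁ →
        CleanPermissibleAt p (RatFn.toFunctionField (σ₁ y)) G (stalkIdeal (vanishingIdeal C₀) (σ₁ y)) →
        CleanPermissibleAt p (RatFn.toFunctionField y) (RatFn.functionFieldMap σ₁ G) (stalkIdeal (vanishingIdeal C₁) y) := by
      intro y hyC hyx hgood
      obtain ⟨-, hne, -⟩ := hoff y hyC hyx
      exact hchain.cleanPermissibleAt_of_ne hx₀cl p G y hne hgood
    have hη₁x : η₁ ≠ x₁ := by
      intro h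
      apply hx₀η
      rw [← hση₁, h]
    have hη₁good : CleanPermissibleAt p (RatFn.toFunctionField η₁) (RatFn.functionFieldMap σ₁ G) (stalkIdeal (vanishingIdeal C₁) η₁) :=
      htransport η₁ hη₁C hη₁x (by rw [hση₁]; exact hηgood)
    have hGbad₁ : ∀ y ∈ (C₁ : Set X₁),
        ¬ CleanPermissibleAt p (RatFn.toFunctionField y) (RatFn.functionFieldMap σ₁ G) (stalkIdeal (vanishingIdeal C₁) y) →
        CleanRegAt p (RatFn.toFunctionField y) (RatFn.functionFieldMap σ₁ G) := by
      intro y hyC hybad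
      have hyx : y ≠ x₁ := by rintro rfl; exact hybad hx₁good
      obtain ⟨hyC₀, -, hlift⟩ := hoff y hyC hyx
      have hybad₀ : ¬ CleanPermissibleAt p (RatFn.toFunctionField (σ₁ y)) G (stalkIdeal (vanishingIdeal C₀) (σ₁ y)) :=
        fun hgood => hybad (htransport y hyC hyx hgood)
      exact hlift (hGbad _ hyC₀ hybad₀)
    have hN₁ : {y : X₁ | y ∈ (C₁ : Set X₁) ∧
        ¬ CleanPermissibleAt p (RatFn.toFunctionField y) (RatFn.functionFieldMap σ₁ G) (stalkIdeal (vanishingIdeal C₁) y)}.ncard ≤ N := by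
      omega
    -- induction
    obtain ⟨X₂, hX₂i, hX₂n, σ₂, hσ₂d, C₂, η₂, hprop₂, hiso₂, hX₂, hE₂, hC₂reg, hη₂, hση₂, hall₂⟩ :=
      ih hX₁ hE₁ hC₁reg hη₁ hcl₁ hdim3₁ (RatFn.functionFieldMap σ₁ G) hη₁good hGbad₁ hfin₁ hN₁
    haveI := hprop₂
    haveI : IsProper σ₁ := hchain.isProper
    refine ⟨X₂, hX₂i, hX₂n, σ₂ ≫ σ₁, inferInstance, C₂, η₂, inferInstance, ?_, hX₂, hE₂, hC₂reg, hη₂, ?_, ?_⟩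
    · -- isomorphism over the good opens
      intro U hU
      have hx₀U : σ₁ x₁ ∉ U := fun h => hx₀bad (hU _ hx₀C h)
      haveI : IsIso (σ₁ ∣_ U) := hchain.isIso_morphismRestrict U hx₀U
      rw [morphismRestrict_comp]
      refine @IsIso.comp_isIso _ _ _ _ _ _ _ ?_ inferInstance
      refine hiso₂ _ fun y hyC hyU => ?_
      have hyU' : σ₁ y ∈ U := hyU
      have hyx : y ≠ x₁ := fun h => hx₀U (by rw [← h]; exact hyU')
      obtain ⟨hyC₀, -, -⟩ := hoff y hyC hyx
      exact htransport y hyC hyx (hU _ hyC₀ hyU')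
    · rw [Scheme.Hom.comp_apply, hση₂, hση₁]
    · intro y hy
      rw [RatFn.functionFieldMap_comp σ₁ σ₂, RingHom.comp_apply]
      exact hall₂ y hy

/-- **L7b-global** (the bound instantiated).  See the module docstring. [cite: CossartPiltant2008, Prop. 4.4 (proof, p. 10)]
[cite: Piltant2013, §2 Axiom 4] [cite: CossartJannsenSaito2020, proof of Thm. 6.28, Step 5] -/
theorem exists_proper_isIso_forall_cleanPermissibleAt {X₀ : Scheme.{0}} [IsIntegral X₀] [IsLocallyNoetherian X₀]
    (hX₀ : Scheme.IsRegular X₀) (hE : Scheme.IsQuasiExcellent X₀) (p : ℕ) [hp : Fact p.Prime] [CharP X₀.functionField p] {C₀ : Closeds X₀}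
    (hC₀reg : ∀ y ∈ (C₀ : Set X₀), ∃ c : Fin 2 → X₀.presheaf.stalk y,
      IsRsopPart c ∧ Ideal.span (Set.range c) = stalkIdeal (vanishingIdeal C₀) y)
    {η : X₀} (hη : (C₀ : Set X₀) = closure {η}) (hcl : ∀ y ∈ (C₀ : Set X₀), y ≠ η → IsClosed ({y} : Set X₀))
    (hdim3 : ∀ y ∈ (C₀ : Set X₀), y ≠ η → ringKrullDim (X₀.presheaf.stalk y) = 3) (G : X₀.functionField)
    (hηgood : CleanPermissibleAt p (RatFn.toFunctionField η) G (stalkIdeal (vanishingIdeal C₀) η))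
    (hGbad : ∀ y ∈ (C₀ : Set X₀), ¬ CleanPermissibleAt p (RatFn.toFunctionField y) G (stalkIdeal (vanishingIdeal C₀) y) →
      CleanRegAt p (RatFn.toFunctionField y) G)
    (hfin : {y : X₀ | y ∈ (C₀ : Set X₀) ∧ ¬ CleanPermissibleAt p (RatFn.toFunctionField y) G (stalkIdeal (vanishingIdeal C₀) y)}.Finite) :
    ∃ (X : Scheme.{0}) (_ : IsIntegral X) (_ : IsLocallyNoetherian X) (σ : X ⟶ X₀) (_ : IsDominant σ) (C : Closeds X) (η' : X),
      IsProper σ ∧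
      (∀ U : X₀.Opens, (∀ y ∈ (C₀ : Set X₀), y ∈ U → CleanPermissibleAt p (RatFn.toFunctionField y) G (stalkIdeal (vanishingIdeal C₀) y)) →
        IsIso (σ ∣_ U)) ∧
      Scheme.IsRegular X ∧ Scheme.IsQuasiExcellent X ∧
      (∀ y ∈ (C : Set X), ∃ c : Fin 2 → X.presheaf.stalk y, IsRsopPart c ∧ Ideal.span (Set.range c) = stalkIdeal (vanishingIdeal C) y) ∧
      (C : Set X) = closure {η'} ∧ σ η' = η ∧
      ∀ y ∈ (C : Set X), CleanPermissibleAt p (RatFn.toFunctionField y) (RatFn.functionFieldMap σ G) (stalkIdeal (vanishingIdeal C) y) :=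
  exists_proper_isIso_forall_cleanPermissibleAt_of_ncard_le p _ hX₀ hE hC₀reg hη hcl hdim3 G hηgood hGbad hfin le_rfl

end Summit.ResolutionOfSingularities.ResolutionOfSingularities.Theorems.RadicialJung.CleanModels

end
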